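import Summits.AtomisticToContinuum.Crystallization.Theorems.PalmUnimodularRigidityLayeredLawsSelectHcpFrameRigidity
import Summits.AtomisticToContinuum.Crystallization.Theorems.PalmUnimodularRigidityLayeredLawsSelectHcpLocalCongruenceFrames
import Summits.AtomisticToContinuum.Crystallization.Theorems.PalmUnimodularRigidityLayeredLawsSelectHcpReRoot

/-!
# Crux `LayeredLawsSelectHcp` (stmt-AtomisticToContinuum-9226), line `mtp-prestress-split-ergodic-frame`:
# adjacent frames of a rooted chart agree up to the parity sign (`tube_adjacentFrames`, G3b)

Registered sub-goal `tube_adjacentFrames` (G3b of the far-field memo `Cruxes/LayeredLawsSelectHcp/LeadC3FarField.md`,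
§5, §7(b)), the induction step of the dead reckoning along label paths: if `(a, A)` fits the labelled star of a rooted
chart `X` within `a/100` (`‖X v − a • A (Pᵢ v)‖ ≤ a/100`, `v ∈ hcpStarIdx`, `Pᵢ = hcpSite 1 √(2/3)`, as produced by
`tube_chartStarFrame`) and
`(a', A')` fits the star of the chart `reRoot X c` re-rooted at a star label `c` within `a'/100`, then `|a − a'| ≤ 1/50`
and the two frames agree up to the parity sign `σ_c` of the layer of `c` (`labelShift c` is the translation `u ↦ c + u`
on even layers and the point inversion `u ↦ c − u` on odd ones):
`‖a • A v − σ_c • (a' • A' v)‖ ≤ (5/100) ‖v‖` for all `v`.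

* The two stars share FIVE vectors: the bond `X c = −(reRoot X c) c̃` (`labelShift c c̃ = 0`) and, for each of the
  four common neighbours `w` of `0` and `c`, `X w − X c = (reRoot X c) w̃` (`labelShift c w̃ = w`), whose ideal
  counterparts are `σ_c Pᵢ c` and `σ_c (Pᵢ w − Pᵢ c)` (`hcpSite_add_of_even`, `hcpSite_sub_of_odd`).  So the FRAME
  DIFFERENCE `F = a A − σ_c a' A'` has `‖F (Pᵢ c)‖ ≤ (a + a')/100` and `‖F (Pᵢ w − Pᵢ c)‖ ≤ (2a + a')/100`
  (`frame_le_of_near`, `frame_sub_le_of_near` of the sibling module `…FrameRigidity`); the common neighbours and all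
  the inner products of the six ideal sites are a finite table (`adjacent_table`, explicit witnesses checked by
  `decide` on the integer metric `siteQ`; `inner_ideal_star`).
* From the five vectors we form an ORTHOGONAL triple `f` (`Pᵢ c, Pᵢ w₁ − Pᵢ w₂, Pᵢ w₃ − Pᵢ w₄` for in-layer `c`;
  `Pᵢ c − Pᵢ w₃, Pᵢ c + Pᵢ w₃ − 2 Pᵢ w₄, 3 Pᵢ c − Pᵢ w₁ − Pᵢ w₂` for off-layer `c`: `triple_even`, `triple_odd`) with
  explicit `‖F fⱼ‖`.
* The rotation rigidity of the sibling module `…FrameRigidity` (`two_frames_sq_le_of_orthogonal`: the top eigenvalue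
  of `‖x − Rx‖²` is HALF its trace, so `‖F x‖² ≤ ½ (∑ ‖F fⱼ‖²/‖fⱼ‖²) ‖x‖²`) and the table values give
  `‖F x‖² ≤ (5/100)² ‖x‖²` in both cases (`adjacent_even`, `adjacent_odd`; in-layer bonds even give `4/100`).

All `[folklore]`.
-/


noncomputable section

namespace Summit.AtomisticToContinuum.Crystallization.Theorems.PalmUnimodularRigidity.LayeredLawsSelectHcp

open MeasureTheory Set
open Literature.MathematicalPhysics.StatisticalMechanics Literature.Geometry.DiscreteGeometry
open Summit.AtomisticToContinuum.Crystallization.Theorems.LayeredLawsSelectHcp.Negative.DiracLaws (GoodShell)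
open scoped RealInnerProductSpace

variable {E : Type*} [NormedAddCommGroup E] [InnerProductSpace ℝ E]

/-! ## The two combinatorial types of bonds: explicit orthogonal triples -/

/-- **In-layer bond, the triple.** For unit vectors `p, q₁, …, q₄` with `⟪p, qᵢ⟫ = ½`, `⟪q₁, q₂⟫ = −½`,
`⟪q₃, q₄⟫ = −⅓`, `⟪q₁, q₃⟫ = ⟪q₁, q₄⟫ = ½`, `⟪q₂, q₃⟫ = ⟪q₂, q₄⟫ = 0` (the bond `p = Pᵢ c` of an in-layer star label
`c` and its four common neighbours), `p, q₁ − q₂, q₃ − q₄` is an orthogonal triple of square norms `1, 3, 8/3`.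
[folklore] -/
theorem triple_even {p q₁ q₂ q₃ q₄ : E} (hpp : ⟪p, p⟫ = 1) (h11 : ⟪q₁, q₁⟫ = 1) (h22 : ⟪q₂, q₂⟫ = 1)
    (h33 : ⟪q₃, q₃⟫ = 1) (h44 : ⟪q₄, q₄⟫ = 1) (hp1 : ⟪p, q₁⟫ = 1 / 2) (hp2 : ⟪p, q₂⟫ = 1 / 2) (hp3 : ⟪p, q₃⟫ = 1 / 2)
    (hp4 : ⟪p, q₄⟫ = 1 / 2) (h12 : ⟪q₁, q₂⟫ = -1 / 2) (h34 : ⟪q₃, q₄⟫ = -1 / 3) (h13 : ⟪q₁, q₃⟫ = 1 / 2)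
    (h14 : ⟪q₁, q₄⟫ = 1 / 2) (h23 : ⟪q₂, q₃⟫ = 0) (h24 : ⟪q₂, q₄⟫ = 0) :
    ⟪p, p⟫ = 1 ∧ ⟪q₁ - q₂, q₁ - q₂⟫ = 3 ∧ ⟪q₃ - q₄, q₃ - q₄⟫ = 8 / 3 ∧ ⟪p, q₁ - q₂⟫ = 0 ∧ ⟪p, q₃ - q₄⟫ = 0 ∧
      ⟪q₁ - q₂, q₃ - q₄⟫ = 0 := by
  have h21 : ⟪q₂, q₁⟫ = -1 / 2 := by rw [real_inner_comm]; exact h12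
  have h43 : ⟪q₄, q₃⟫ = -1 / 3 := by rw [real_inner_comm]; exact h34
  refine ⟨hpp, ?_, ?_, ?_, ?_, ?_⟩
  · simp only [inner_sub_left, inner_sub_right, h11, h22, h12, h21]; norm_num
  · simp only [inner_sub_left, inner_sub_right, h33, h44, h34, h43]; norm_num
  · simp only [inner_sub_right, hp1, hp2]; norm_num
  · simp only [inner_sub_right, hp3, hp4]; norm_num
  · simp only [inner_sub_left, inner_sub_right, h13, h14, h23, h24]; norm_num

/-- **Off-layer bond, the triple.** For unit vectors `p, q₁, …, q₄` with `⟪p, qᵢ⟫ = ½`, `⟪q₁, q₂⟫ = ⟪q₃, q₄⟫ = ½`,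
`⟪q₁, q₃⟫ = ⟪q₂, q₄⟫ = −½`, `⟪q₂, q₃⟫ = ⟪q₁, q₄⟫ = 0` (the bond of an off-layer star label and its four common
neighbours), `p − q₃, p + q₃ − 2 q₄, 3 p − q₁ − q₂` is an orthogonal triple of square norms `1, 3, 6`. [folklore] -/
theorem triple_odd {p q₁ q₂ q₃ q₄ : E} (hpp : ⟪p, p⟫ = 1) (h11 : ⟪q₁, q₁⟫ = 1) (h22 : ⟪q₂, q₂⟫ = 1)
    (h33 : ⟪q₃, q₃⟫ = 1) (h44 : ⟪q₄, q₄⟫ = 1) (hp1 : ⟪p, q₁⟫ = 1 / 2) (hp2 : ⟪p, q₂⟫ = 1 / 2) (hp3 : ⟪p, q₃⟫ = 1 / 2)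
    (hp4 : ⟪p, q₄⟫ = 1 / 2) (h12 : ⟪q₁, q₂⟫ = 1 / 2) (h34 : ⟪q₃, q₄⟫ = 1 / 2) (h13 : ⟪q₁, q₃⟫ = -1 / 2)
    (h23 : ⟪q₂, q₃⟫ = 0) (h14 : ⟪q₁, q₄⟫ = 0) (h24 : ⟪q₂, q₄⟫ = -1 / 2) :
    ⟪p - q₃, p - q₃⟫ = 1 ∧ ⟪p + q₃ - (2 : ℝ) • q₄, p + q₃ - (2 : ℝ) • q₄⟫ = 3 ∧
      ⟪(3 : ℝ) • p - q₁ - q₂, (3 : ℝ) • p - q₁ - q₂⟫ = 6 ∧ ⟪p - q₃, p + q₃ - (2 : ℝ) • q₄⟫ = 0 ∧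
      ⟪p - q₃, (3 : ℝ) • p - q₁ - q₂⟫ = 0 ∧ ⟪p + q₃ - (2 : ℝ) • q₄, (3 : ℝ) • p - q₁ - q₂⟫ = 0 := by
  have h21 : ⟪q₂, q₁⟫ = 1 / 2 := by rw [real_inner_comm]; exact h12
  have h43 : ⟪q₄, q₃⟫ = 1 / 2 := by rw [real_inner_comm]; exact h34
  have h31 : ⟪q₃, q₁⟫ = -1 / 2 := by rw [real_inner_comm]; exact h13
  have h41 : ⟪q₄, q₁⟫ = 0 := by rw [real_inner_comm]; exact h14
  have h32 : ⟪q₃, q₂⟫ = 0 := by rw [real_inner_comm]; exact h23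
  have h42 : ⟪q₄, q₂⟫ = -1 / 2 := by rw [real_inner_comm]; exact h24
  have h1p : ⟪q₁, p⟫ = 1 / 2 := by rw [real_inner_comm]; exact hp1
  have h2p : ⟪q₂, p⟫ = 1 / 2 := by rw [real_inner_comm]; exact hp2
  have h3p : ⟪q₃, p⟫ = 1 / 2 := by rw [real_inner_comm]; exact hp3
  have h4p : ⟪q₄, p⟫ = 1 / 2 := by rw [real_inner_comm]; exact hp4
  refine ⟨?_, ?_, ?_, ?_, ?_, ?_⟩
  · simp only [inner_sub_left, inner_sub_right, hpp, h33, hp3, h3p]; norm_num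
  · simp only [inner_sub_left, inner_sub_right, inner_add_left, inner_add_right, real_inner_smul_left,
      real_inner_smul_right, hpp, h33, h44, hp3, h3p, hp4, h4p, h34, h43]; norm_num
  · simp only [inner_sub_left, inner_sub_right, real_inner_smul_left, real_inner_smul_right, hpp, h11, h22,
      hp1, h1p, hp2, h2p, h12, h21]; norm_num
  · simp only [inner_sub_left, inner_sub_right, inner_add_right, real_inner_smul_right, hpp, h33, hp3, h3p,
      hp4, h34]; norm_num
  · simp only [inner_sub_left, inner_sub_right, real_inner_smul_right, hpp, hp1, hp2, h3p, h31, h32]; norm_num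
  · simp only [inner_sub_left, inner_sub_right, inner_add_left, real_inner_smul_left, real_inner_smul_right, hpp,
      hp1, hp2, h3p, h31, h32, h4p, h41, h42]; norm_num

/-- **In-layer bond, the numbers.** If a linear map `F` (the frame difference) has `‖F p‖ ≤ (a+a')/100` on the bond
and `‖F (qᵢ − p)‖ ≤ (2a+a')/100` on the four common-neighbour bonds (`a, a' ∈ [9/10, 1]`), and obeys the rotation
rigidity bound on the triple `p, q₁ − q₂, q₃ − q₄` (square norms `1, 3, 8/3`), then `‖F v‖ ≤ (5/100) ‖v‖`
(indeed `4/100`). [folklore] -/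
theorem adjacent_even (F : E →ₗ[ℝ] E) {a a' : ℝ} (h9 : 9 / 10 ≤ a) (h1 : a ≤ 1) (h9' : 9 / 10 ≤ a')
    (h1' : a' ≤ 1) {p q₁ q₂ q₃ q₄ : E} (hB0 : ‖F p‖ ≤ a / 100 + a' / 100)
    (hB1 : ‖F (q₁ - p)‖ ≤ a / 100 + a / 100 + a' / 100) (hB2 : ‖F (q₂ - p)‖ ≤ a / 100 + a / 100 + a' / 100)
    (hB3 : ‖F (q₃ - p)‖ ≤ a / 100 + a / 100 + a' / 100) (hB4 : ‖F (q₄ - p)‖ ≤ a / 100 + a / 100 + a' / 100)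
    (hrig : ‖F p‖ ^ 2 / 1 + ‖F (q₁ - q₂)‖ ^ 2 / 3 + ‖F (q₃ - q₄)‖ ^ 2 / (8 / 3) < 4 * a * a' →
      ∀ x, ‖F x‖ ^ 2 ≤ (1 / 2) * (‖F p‖ ^ 2 / 1 + ‖F (q₁ - q₂)‖ ^ 2 / 3 + ‖F (q₃ - q₄)‖ ^ 2 / (8 / 3)) * ‖x‖ ^ 2)
    (v : E) : ‖F v‖ ≤ 5 / 100 * ‖v‖ := by
  have hF2 : ‖F (q₁ - q₂)‖ ≤ 2 * (a / 100 + a / 100 + a' / 100) := by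
    have h : q₁ - q₂ = (q₁ - p) - (q₂ - p) := by abel
    rw [h, map_sub]
    linarith [norm_sub_le (F (q₁ - p)) (F (q₂ - p))]
  have hF3 : ‖F (q₃ - q₄)‖ ≤ 2 * (a / 100 + a / 100 + a' / 100) := by
    have h : q₃ - q₄ = (q₃ - p) - (q₄ - p) := by abel
    rw [h, map_sub]
    linarith [norm_sub_le (F (q₃ - p)) (F (q₄ - p))]
  have hd0 : a / 100 + a' / 100 ≤ 1 / 50 := by linarith
  have hd1 : 2 * (a / 100 + a / 100 + a' / 100) ≤ 6 / 100 := by linarith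
  have s0 : ‖F p‖ ^ 2 ≤ (1 / 50) ^ 2 := pow_le_pow_left₀ (norm_nonneg _) (hB0.trans hd0) 2
  have s2 : ‖F (q₁ - q₂)‖ ^ 2 ≤ (6 / 100) ^ 2 := pow_le_pow_left₀ (norm_nonneg _) (hF2.trans hd1) 2
  have s3 : ‖F (q₃ - q₄)‖ ^ 2 ≤ (6 / 100) ^ 2 := pow_le_pow_left₀ (norm_nonneg _) (hF3.trans hd1) 2
  have hS : ‖F p‖ ^ 2 / 1 + ‖F (q₁ - q₂)‖ ^ 2 / 3 + ‖F (q₃ - q₄)‖ ^ 2 / (8 / 3) ≤ 2 * (5 / 100) ^ 2 := by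
    linarith only [s0, s2, s3]
  have haa : 9 / 10 * (9 / 10) ≤ a * a' := mul_le_mul h9 h9' (by norm_num) (by linarith)
  have hmain := hrig (by linarith only [hS, haa]) v
  have hsq : ‖F v‖ ^ 2 ≤ (5 / 100 * ‖v‖) ^ 2 := by nlinarith only [hmain, hS, sq_nonneg ‖v‖]
  exact (sq_le_sq₀ (norm_nonneg _) (by positivity)).1 hsq

/-- **Off-layer bond, the numbers.** The same with the triple `p − q₃, p + q₃ − 2 q₄, 3 p − q₁ − q₂` (square norms
`1, 3, 6`), on which `F` is within `(2a+a')/100, 3(2a+a')/100, (a+a')/100 + 2(2a+a')/100`. [folklore] -/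
theorem adjacent_odd (F : E →ₗ[ℝ] E) {a a' : ℝ} (h9 : 9 / 10 ≤ a) (h1 : a ≤ 1) (h9' : 9 / 10 ≤ a')
    (h1' : a' ≤ 1) {p q₁ q₂ q₃ q₄ : E} (hB0 : ‖F p‖ ≤ a / 100 + a' / 100)
    (hB1 : ‖F (q₁ - p)‖ ≤ a / 100 + a / 100 + a' / 100) (hB2 : ‖F (q₂ - p)‖ ≤ a / 100 + a / 100 + a' / 100)
    (hB3 : ‖F (q₃ - p)‖ ≤ a / 100 + a / 100 + a' / 100) (hB4 : ‖F (q₄ - p)‖ ≤ a / 100 + a / 100 + a' / 100)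
    (hrig : ‖F (p - q₃)‖ ^ 2 / 1 + ‖F (p + q₃ - (2 : ℝ) • q₄)‖ ^ 2 / 3 + ‖F ((3 : ℝ) • p - q₁ - q₂)‖ ^ 2 / 6 <
        4 * a * a' →
      ∀ x, ‖F x‖ ^ 2 ≤ (1 / 2) * (‖F (p - q₃)‖ ^ 2 / 1 + ‖F (p + q₃ - (2 : ℝ) • q₄)‖ ^ 2 / 3 +
        ‖F ((3 : ℝ) • p - q₁ - q₂)‖ ^ 2 / 6) * ‖x‖ ^ 2)
    (v : E) : ‖F v‖ ≤ 5 / 100 * ‖v‖ := by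
  have hF1 : ‖F (p - q₃)‖ ≤ a / 100 + a / 100 + a' / 100 := by
    rw [← neg_sub, map_neg, norm_neg]; exact hB3
  have hF2 : ‖F (p + q₃ - (2 : ℝ) • q₄)‖ ≤ 3 * (a / 100 + a / 100 + a' / 100) := by
    have h : p + q₃ - (2 : ℝ) • q₄ = (q₃ - p) - (2 : ℝ) • (q₄ - p) := by module
    rw [h, map_sub, map_smul]
    calc ‖F (q₃ - p) - (2 : ℝ) • F (q₄ - p)‖ ≤ ‖F (q₃ - p)‖ + ‖(2 : ℝ) • F (q₄ - p)‖ := norm_sub_le _ _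
      _ = ‖F (q₃ - p)‖ + 2 * ‖F (q₄ - p)‖ := by rw [norm_smul, Real.norm_two]
      _ ≤ 3 * (a / 100 + a / 100 + a' / 100) := by linarith
  have hF3 : ‖F ((3 : ℝ) • p - q₁ - q₂)‖ ≤ (a / 100 + a' / 100) + 2 * (a / 100 + a / 100 + a' / 100) := by
    have h : (3 : ℝ) • p - q₁ - q₂ = p - (q₁ - p) - (q₂ - p) := by module
    rw [h, map_sub, map_sub]
    calc ‖F p - F (q₁ - p) - F (q₂ - p)‖ ≤ ‖F p - F (q₁ - p)‖ + ‖F (q₂ - p)‖ := norm_sub_le _ _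
      _ ≤ ‖F p‖ + ‖F (q₁ - p)‖ + ‖F (q₂ - p)‖ := by gcongr; exact norm_sub_le _ _
      _ ≤ (a / 100 + a' / 100) + 2 * (a / 100 + a / 100 + a' / 100) := by linarith
  have hd1 : a / 100 + a / 100 + a' / 100 ≤ 3 / 100 := by linarith
  have hd2 : 3 * (a / 100 + a / 100 + a' / 100) ≤ 9 / 100 := by linarith
  have hd3 : (a / 100 + a' / 100) + 2 * (a / 100 + a / 100 + a' / 100) ≤ 8 / 100 := by linarith
  have s1 : ‖F (p - q₃)‖ ^ 2 ≤ (3 / 100) ^ 2 := pow_le_pow_left₀ (norm_nonneg _) (hF1.trans hd1) 2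
  have s2 : ‖F (p + q₃ - (2 : ℝ) • q₄)‖ ^ 2 ≤ (9 / 100) ^ 2 := pow_le_pow_left₀ (norm_nonneg _) (hF2.trans hd2) 2
  have s3 : ‖F ((3 : ℝ) • p - q₁ - q₂)‖ ^ 2 ≤ (8 / 100) ^ 2 := pow_le_pow_left₀ (norm_nonneg _) (hF3.trans hd3) 2
  have hS : ‖F (p - q₃)‖ ^ 2 / 1 + ‖F (p + q₃ - (2 : ℝ) • q₄)‖ ^ 2 / 3 + ‖F ((3 : ℝ) • p - q₁ - q₂)‖ ^ 2 / 6 ≤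
      2 * (5 / 100) ^ 2 := by
    linarith only [s1, s2, s3]
  have haa : 9 / 10 * (9 / 10) ≤ a * a' := mul_le_mul h9 h9' (by norm_num) (by linarith)
  have hmain := hrig (by linarith only [hS, haa]) v
  have hsq : ‖F v‖ ^ 2 ≤ (5 / 100 * ‖v‖) ^ 2 := by nlinarith only [hmain, hS, sq_nonneg ‖v‖]
  exact (sq_le_sq₀ (norm_nonneg _) (by positivity)).1 hsq

/-! ## The common neighbours of the twelve bonds: a finite table -/

/-- Inner products of ideal star struts from the integer metric: `⟪Pᵢ v, Pᵢ w⟫ = 1 − (q₁ + 8 q₂)/24` for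
`siteQ v w = (q₁, q₂)` (`dist² = q₁/12 + (2/3) q₂`). [folklore] -/
theorem inner_ideal_star {v w : ℤ × ℤ × ℤ} (hv : v ∈ hcpStarIdx) (hw : w ∈ hcpStarIdx) {t : ℤ}
    (ht : (siteQ v w).1 + 8 * (siteQ v w).2 = t) :
    ⟪hcpSite 1 (Real.sqrt (2 / 3)) v, hcpSite 1 (Real.sqrt (2 / 3)) w⟫ = 1 - (t : ℝ) / 24 := by
  have hd := hcpSite_dist_sq 1 (Real.sqrt (2 / 3)) v w
  rw [Real.sq_sqrt (by norm_num : (0 : ℝ) ≤ 2 / 3), one_pow, dist_eq_norm] at hd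
  have ht' : ((siteQ v w).1 : ℝ) + 8 * (siteQ v w).2 = t := by exact_mod_cast ht
  rw [real_inner_eq_norm_mul_self_add_norm_mul_self_sub_norm_sub_mul_self_div_two, norm_ideal_strut hv,
    norm_ideal_strut hw]
  linear_combination (-1 / 2 : ℝ) * hd - (1 / 24 : ℝ) * ht'

/-- **The table of the twelve bonds** (explicit witnesses, checked by `decide`): for each star label `c = starLab m`
there are four star labels `w₁, …, w₄` touching `c` (`12·dist² = 12`) such that, for `c` in the layer of the root
(even), `−c` and the `wᵢ − c` are star labels and the mutual `12·dist²` of the `wᵢ` are `36, 32, 12, 12, 24, 24`,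
while for `c` off the layer (odd) the `c − wᵢ` are star labels and the mutual values are `12, 12, 36, 24, 24, 36`
(`w₁, w₂` in the layer of the root, `w₃, w₄` off it). [folklore] -/
theorem adjacent_table : ∀ m : Fin 12, ∃ n₁ n₂ n₃ n₄ : Fin 12,
    (siteQ (starLab m) (starLab n₁)).1 + 8 * (siteQ (starLab m) (starLab n₁)).2 = 12 ∧
    (siteQ (starLab m) (starLab n₂)).1 + 8 * (siteQ (starLab m) (starLab n₂)).2 = 12 ∧
    (siteQ (starLab m) (starLab n₃)).1 + 8 * (siteQ (starLab m) (starLab n₃)).2 = 12 ∧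
    (siteQ (starLab m) (starLab n₄)).1 + 8 * (siteQ (starLab m) (starLab n₄)).2 = 12 ∧
    ((Even (starLab m).1 ∧ -starLab m ∈ hcpStarIdx ∧
        starLab n₁ - starLab m ∈ hcpStarIdx ∧ starLab n₂ - starLab m ∈ hcpStarIdx ∧
        starLab n₃ - starLab m ∈ hcpStarIdx ∧ starLab n₄ - starLab m ∈ hcpStarIdx ∧
        (siteQ (starLab n₁) (starLab n₂)).1 + 8 * (siteQ (starLab n₁) (starLab n₂)).2 = 36 ∧
        (siteQ (starLab n₃) (starLab n₄)).1 + 8 * (siteQ (starLab n₃) (starLab n₄)).2 = 32 ∧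
        (siteQ (starLab n₁) (starLab n₃)).1 + 8 * (siteQ (starLab n₁) (starLab n₃)).2 = 12 ∧
        (siteQ (starLab n₁) (starLab n₄)).1 + 8 * (siteQ (starLab n₁) (starLab n₄)).2 = 12 ∧
        (siteQ (starLab n₂) (starLab n₃)).1 + 8 * (siteQ (starLab n₂) (starLab n₃)).2 = 24 ∧
        (siteQ (starLab n₂) (starLab n₄)).1 + 8 * (siteQ (starLab n₂) (starLab n₄)).2 = 24) ∨
      (¬Even (starLab m).1 ∧
        starLab m - starLab n₁ ∈ hcpStarIdx ∧ starLab m - starLab n₂ ∈ hcpStarIdx ∧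
        starLab m - starLab n₃ ∈ hcpStarIdx ∧ starLab m - starLab n₄ ∈ hcpStarIdx ∧
        (siteQ (starLab n₁) (starLab n₂)).1 + 8 * (siteQ (starLab n₁) (starLab n₂)).2 = 12 ∧
        (siteQ (starLab n₃) (starLab n₄)).1 + 8 * (siteQ (starLab n₃) (starLab n₄)).2 = 12 ∧
        (siteQ (starLab n₁) (starLab n₃)).1 + 8 * (siteQ (starLab n₁) (starLab n₃)).2 = 36 ∧
        (siteQ (starLab n₂) (starLab n₃)).1 + 8 * (siteQ (starLab n₂) (starLab n₃)).2 = 24 ∧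
        (siteQ (starLab n₁) (starLab n₄)).1 + 8 * (siteQ (starLab n₁) (starLab n₄)).2 = 24 ∧
        (siteQ (starLab n₂) (starLab n₄)).1 + 8 * (siteQ (starLab n₂) (starLab n₄)).2 = 36)) := by
  intro m
  fin_cases m
  · refine ⟨1, 4, 2, 3, ?_, ?_, ?_, ?_, Or.inl ⟨?_, ?_, ?_, ?_, ?_, ?_, ?_, ?_, ?_, ?_, ?_, ?_⟩⟩ <;> decide
  · refine ⟨0, 10, 2, 3, ?_, ?_, ?_, ?_, Or.inl ⟨?_, ?_, ?_, ?_, ?_, ?_, ?_, ?_, ?_, ?_, ?_, ?_⟩⟩ <;> decide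
  · refine ⟨0, 1, 8, 5, ?_, ?_, ?_, ?_, Or.inr ⟨?_, ?_, ?_, ?_, ?_, ?_, ?_, ?_, ?_, ?_, ?_⟩⟩ <;> decide
  · refine ⟨0, 1, 11, 7, ?_, ?_, ?_, ?_, Or.inr ⟨?_, ?_, ?_, ?_, ?_, ?_, ?_, ?_, ?_, ?_, ?_⟩⟩ <;> decide
  · refine ⟨6, 0, 5, 7, ?_, ?_, ?_, ?_, Or.inl ⟨?_, ?_, ?_, ?_, ?_, ?_, ?_, ?_, ?_, ?_, ?_, ?_⟩⟩ <;> decide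
  · refine ⟨6, 4, 2, 8, ?_, ?_, ?_, ?_, Or.inr ⟨?_, ?_, ?_, ?_, ?_, ?_, ?_, ?_, ?_, ?_, ?_⟩⟩ <;> decide
  · refine ⟨4, 9, 5, 7, ?_, ?_, ?_, ?_, Or.inl ⟨?_, ?_, ?_, ?_, ?_, ?_, ?_, ?_, ?_, ?_, ?_, ?_⟩⟩ <;> decide
  · refine ⟨6, 4, 3, 11, ?_, ?_, ?_, ?_, Or.inr ⟨?_, ?_, ?_, ?_, ?_, ?_, ?_, ?_, ?_, ?_, ?_⟩⟩ <;> decide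
  · refine ⟨10, 9, 5, 2, ?_, ?_, ?_, ?_, Or.inr ⟨?_, ?_, ?_, ?_, ?_, ?_, ?_, ?_, ?_, ?_, ?_⟩⟩ <;> decide
  · refine ⟨10, 6, 8, 11, ?_, ?_, ?_, ?_, Or.inl ⟨?_, ?_, ?_, ?_, ?_, ?_, ?_, ?_, ?_, ?_, ?_, ?_⟩⟩ <;> decide
  · refine ⟨9, 1, 8, 11, ?_, ?_, ?_, ?_, Or.inl ⟨?_, ?_, ?_, ?_, ?_, ?_, ?_, ?_, ?_, ?_, ?_, ?_⟩⟩ <;> decide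
  · refine ⟨10, 9, 7, 3, ?_, ?_, ?_, ?_, Or.inr ⟨?_, ?_, ?_, ?_, ?_, ?_, ?_, ?_, ?_, ?_, ?_⟩⟩ <;> decide

/-! ## The registered stub -/

/-- **Registered sub-goal `tube_adjacentFrames` (G3b): adjacent frames of a rooted chart agree up to the parity
sign.**  If `(a, A)` fits the labelled star of a rooted chart `X` within `a/100` and `(a', A')` fits the star of the
chart re-rooted at the star label `c` within `a'/100` (`a, a' ∈ [9/10, 1]`), then `|a − a'| ≤ 1/50` and
`‖a • A v − σ_c • (a' • A' v)‖ ≤ (5/100) ‖v‖` for all `v`, `σ_c = 1` for `c` in an even layer and `−1` in an odd one.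
The bond and the four common neighbours of `0` and `c` are shared by the two stars (`adjacent_table`,
`hcpSite_add_of_even`, `hcpSite_sub_of_odd`); they control the frame difference on an explicit orthogonal triple
(`triple_even`, `triple_odd`), the rotation rigidity `two_frames_sq_le_of_orthogonal` (top eigenvalue of `‖x − Rx‖²`
= half the trace) propagates the control to all of `ℝ³`, and `adjacent_even`, `adjacent_odd` do the numbers.
(`GoodShell`, `HcpCharted` and all of `IsRootedChart` but `X 0 = 0` are context and not used.) [folklore] -/
theorem tube_adjacentFrames : ∀ (S : Set (EuclideanSpace ℝ (Fin 3))), (∀ x ∈ S, GoodShell S x) → HcpCharted S → ∀ X : ℤ × ℤ × ℤ → EuclideanSpace ℝ (Fin 3), IsRootedChart S X → ∀ c ∈ hcpStarIdx, ∀ (a : ℝ) (A : EuclideanSpace ℝ (Fin 3) ≃ₗᵢ[ℝ] EuclideanSpace ℝ (Fin 3)) (a' : ℝ) (A' : EuclideanSpace ℝ (Fin 3) ≃ₗᵢ[ℝ] EuclideanSpace ℝ (Fin 3)), 9 / 10 ≤ a → a ≤ 1 → 9 / 10 ≤ a' → a' ≤ 1 → (∀ v ∈ hcpStarIdx, ‖X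 v - a • A (hcpSite 1 (Real.sqrt (2 / 3)) v)‖ ≤ a / 100) → (∀ v ∈ hcpStarIdx, ‖reRoot X c v - a' • A' (hcpSite 1 (Real.sqrt (2 / 3)) v)‖ ≤ a' / 100) → |a - a'| ≤ 1 / 50 ∧ ∀ v : EuclideanSpace ℝ (Fin 3), ‖a • A v - (if Even c.1 then (1 : ℝ) else -1) • (a' • A' v)‖ ≤ 5 / 100 * ‖v‖ := by
  intro S _ _ X hX c hc a A a' A' h9 h1 h9' h1' hA hA'
  have hX0 : X 0 = 0 := hX.1
  have ha : 0 < a := by linarith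
  have ha' : 0 < a' := by linarith
  have hn : Module.finrank ℝ (EuclideanSpace ℝ (Fin 3)) = 3 := finrank_euclideanSpace_fin
  obtain ⟨m, rfl⟩ := exists_starLab_eq hc
  obtain ⟨n₁, n₂, n₃, n₄, hT1, hT2, hT3, hT4, htab⟩ := adjacent_table m
  -- inner products of ideal star struts from the table
  have ip : ∀ (n n' : Fin 12) (t : ℤ), (siteQ (starLab n) (starLab n')).1 + 8 * (siteQ (starLab n) (starLab n')).2 = t →
      ⟪hcpSite 1 (Real.sqrt (2 / 3)) (starLab n), hcpSite 1 (Real.sqrt (2 / 3)) (starLab n')⟫ = 1 - (t : ℝ) / 24 :=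
    fun n n' t h => inner_ideal_star (starLab_mem n) (starLab_mem n') h
  have ipn : ∀ n : Fin 12, ⟪hcpSite 1 (Real.sqrt (2 / 3)) (starLab n), hcpSite 1 (Real.sqrt (2 / 3)) (starLab n)⟫ = 1 :=
    fun n => by rw [real_inner_self_eq_norm_sq, norm_ideal_strut (starLab_mem n), one_pow]
  have hXc := hA _ (starLab_mem m)
  -- the frame difference as a linear map
  have hlin : ∀ s : ℝ, ∃ F : EuclideanSpace ℝ (Fin 3) →ₗ[ℝ] EuclideanSpace ℝ (Fin 3),
      ∀ v, F v = a • A v - s • (a' • A' v) := fun s =>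
    ⟨a • (A.toLinearEquiv : EuclideanSpace ℝ (Fin 3) →ₗ[ℝ] EuclideanSpace ℝ (Fin 3)) -
      (s * a') • (A'.toLinearEquiv : EuclideanSpace ℝ (Fin 3) →ₗ[ℝ] EuclideanSpace ℝ (Fin 3)),
      fun v => by simp [mul_smul]⟩
  rcases htab with ⟨hE, hneg, hm₁, hm₂, hm₃, hm₄, hT12, hT34, hT13, hT14, hT23, hT24⟩ |
    ⟨hE, hm₁, hm₂, hm₃, hm₄, hT12, hT34, hT13, hT23, hT14, hT24⟩
  · -- `c` in the layer of the root: `labelShift c u = c + u`, sign `+1`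
    have hA1 : ‖X (starLab m) - (1 : ℝ) • (a' • A' (hcpSite 1 (Real.sqrt (2 / 3)) (starLab m)))‖ ≤ a' / 100 := by
      have h := hA' (-starLab m) hneg
      have hl : labelShift (starLab m) (-starLab m) = 0 := by
        unfold labelShift; rw [if_pos hE, add_neg_cancel]
      have hP : hcpSite 1 (Real.sqrt (2 / 3)) (-starLab m) = -hcpSite 1 (Real.sqrt (2 / 3)) (starLab m) := by
        have h' := hcpSite_add_of_even 1 (Real.sqrt (2 / 3)) hE (-starLab m)
        rw [add_neg_cancel, hcpSite_zero] at h'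
        exact (neg_eq_of_add_eq_zero_right h'.symm).symm
      have e : X (starLab m) - (1 : ℝ) • (a' • A' (hcpSite 1 (Real.sqrt (2 / 3)) (starLab m))) =
          -(reRoot X (starLab m) (-starLab m) - a' • A' (hcpSite 1 (Real.sqrt (2 / 3)) (-starLab m))) := by
        unfold reRoot; rw [hl, hX0, hP, map_neg, smul_neg, one_smul]; abel
      rw [e, norm_neg]; exact h
    have hA2 : ∀ n : Fin 12, starLab n - starLab m ∈ hcpStarIdx →
        ‖(X (starLab n) - X (starLab m)) - (1 : ℝ) • (a' • A' (hcpSite 1 (Real.sqrt (2 / 3)) (starLab n) -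
          hcpSite 1 (Real.sqrt (2 / 3)) (starLab m)))‖ ≤ a' / 100 := by
      intro n hn
      have h := hA' _ hn
      have hl : labelShift (starLab m) (starLab n - starLab m) = starLab n := by
        unfold labelShift; rw [if_pos hE, add_sub_cancel]
      have hP : hcpSite 1 (Real.sqrt (2 / 3)) (starLab n - starLab m) =
          hcpSite 1 (Real.sqrt (2 / 3)) (starLab n) - hcpSite 1 (Real.sqrt (2 / 3)) (starLab m) := by
        have h' := hcpSite_add_of_even 1 (Real.sqrt (2 / 3)) hE (starLab n - starLab m)
        rw [add_sub_cancel] at h'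
        rw [h']; abel
      have e : (X (starLab n) - X (starLab m)) - (1 : ℝ) • (a' • A' (hcpSite 1 (Real.sqrt (2 / 3)) (starLab n) -
          hcpSite 1 (Real.sqrt (2 / 3)) (starLab m))) =
          reRoot X (starLab m) (starLab n - starLab m) - a' • A' (hcpSite 1 (Real.sqrt (2 / 3)) (starLab n - starLab m)) := by
        unfold reRoot; rw [hl, hP, one_smul]
      rw [e]; exact h
    obtain ⟨F, hF⟩ := hlin 1
    have hB0 : ‖F (hcpSite 1 (Real.sqrt (2 / 3)) (starLab m))‖ ≤ a / 100 + a' / 100 := by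
      rw [hF]; exact frame_le_of_near hXc hA1
    have hB : ∀ n : Fin 12, starLab n - starLab m ∈ hcpStarIdx →
        ‖F (hcpSite 1 (Real.sqrt (2 / 3)) (starLab n) - hcpSite 1 (Real.sqrt (2 / 3)) (starLab m))‖ ≤
          a / 100 + a / 100 + a' / 100 := fun n hn => by
      rw [hF]; exact frame_sub_le_of_near (hA _ (starLab_mem n)) hXc (hA2 n hn)
    obtain ⟨o11, o22, o33, o12, o13, o23⟩ := triple_even (ipn m) (ipn n₁) (ipn n₂) (ipn n₃) (ipn n₄)
      (by rw [ip _ _ _ hT1]; norm_num) (by rw [ip _ _ _ hT2]; norm_num) (by rw [ip _ _ _ hT3]; norm_num)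
      (by rw [ip _ _ _ hT4]; norm_num) (by rw [ip _ _ _ hT12]; norm_num) (by rw [ip _ _ _ hT34]; norm_num)
      (by rw [ip _ _ _ hT13]; norm_num) (by rw [ip _ _ _ hT14]; norm_num) (by rw [ip _ _ _ hT23]; norm_num)
      (by rw [ip _ _ _ hT24]; norm_num)
    refine ⟨(abs_sub_le_of_near (Or.inl rfl) ha.le ha'.le (norm_ideal_strut (starLab_mem m)) hXc hA1).trans
      (by linarith), fun v => ?_⟩
    rw [if_pos hE, ← hF]
    refine adjacent_even F h9 h1 h9' h1' hB0 (hB _ hm₁) (hB _ hm₂) (hB _ hm₃) (hB _ hm₄) (fun h4 x => ?_) v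
    simp only [hF] at h4 ⊢
    exact two_frames_sq_le_of_orthogonal hn A A' (Or.inl rfl) ha ha' one_pos (by norm_num) (by norm_num) o11 o22
      o33 o12 o13 o23 h4 x
  · -- `c` off the layer of the root: `labelShift c u = c − u`, sign `−1`
    have hO : Odd (starLab m).1 := Int.not_even_iff_odd.1 hE
    have hA1 : ‖X (starLab m) - (-1 : ℝ) • (a' • A' (hcpSite 1 (Real.sqrt (2 / 3)) (starLab m)))‖ ≤ a' / 100 := by
      have h := hA' (starLab m) (starLab_mem m)
      have hl : labelShift (starLab m) (starLab m) = 0 := by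
        unfold labelShift; rw [if_neg hE, sub_self]
      have e : X (starLab m) - (-1 : ℝ) • (a' • A' (hcpSite 1 (Real.sqrt (2 / 3)) (starLab m))) =
          -(reRoot X (starLab m) (starLab m) - a' • A' (hcpSite 1 (Real.sqrt (2 / 3)) (starLab m))) := by
        unfold reRoot; rw [hl, hX0, neg_smul, one_smul]; abel
      rw [e, norm_neg]; exact h
    have hA2 : ∀ n : Fin 12, starLab m - starLab n ∈ hcpStarIdx →
        ‖(X (starLab n) - X (starLab m)) - (-1 : ℝ) • (a' • A' (hcpSite 1 (Real.sqrt (2 / 3)) (starLab n) -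
          hcpSite 1 (Real.sqrt (2 / 3)) (starLab m)))‖ ≤ a' / 100 := by
      intro n hn
      have h := hA' _ hn
      have hl : labelShift (starLab m) (starLab m - starLab n) = starLab n := by
        unfold labelShift; rw [if_neg hE, sub_sub_cancel]
      have hP : hcpSite 1 (Real.sqrt (2 / 3)) (starLab m - starLab n) =
          hcpSite 1 (Real.sqrt (2 / 3)) (starLab m) - hcpSite 1 (Real.sqrt (2 / 3)) (starLab n) :=
        hcpSite_sub_of_odd 1 (Real.sqrt (2 / 3)) hO (starLab n)
      have e : (X (starLab n) - X (starLab m)) - (-1 : ℝ) • (a' • A' (hcpSite 1 (Real.sqrt (2 / 3)) (starLab n) -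
          hcpSite 1 (Real.sqrt (2 / 3)) (starLab m))) = reRoot X (starLab m) (starLab m - starLab n) -
          a' • A' (hcpSite 1 (Real.sqrt (2 / 3)) (starLab m - starLab n)) := by
        unfold reRoot
        rw [hl, hP, neg_smul, one_smul, ← neg_sub (hcpSite 1 (Real.sqrt (2 / 3)) (starLab m)), map_neg, smul_neg]
        abel
      rw [e]; exact h
    obtain ⟨F, hF⟩ := hlin (-1)
    have hB0 : ‖F (hcpSite 1 (Real.sqrt (2 / 3)) (starLab m))‖ ≤ a / 100 + a' / 100 := by
      rw [hF]; exact frame_le_of_near hXc hA1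
    have hB : ∀ n : Fin 12, starLab m - starLab n ∈ hcpStarIdx →
        ‖F (hcpSite 1 (Real.sqrt (2 / 3)) (starLab n) - hcpSite 1 (Real.sqrt (2 / 3)) (starLab m))‖ ≤
          a / 100 + a / 100 + a' / 100 := fun n hn => by
      rw [hF]; exact frame_sub_le_of_near (hA _ (starLab_mem n)) hXc (hA2 n hn)
    obtain ⟨o11, o22, o33, o12, o13, o23⟩ := triple_odd (ipn m) (ipn n₁) (ipn n₂) (ipn n₃) (ipn n₄)
      (by rw [ip _ _ _ hT1]; norm_num) (by rw [ip _ _ _ hT2]; norm_num) (by rw [ip _ _ _ hT3]; norm_num)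
      (by rw [ip _ _ _ hT4]; norm_num) (by rw [ip _ _ _ hT12]; norm_num) (by rw [ip _ _ _ hT34]; norm_num)
      (by rw [ip _ _ _ hT13]; norm_num) (by rw [ip _ _ _ hT23]; norm_num) (by rw [ip _ _ _ hT14]; norm_num)
      (by rw [ip _ _ _ hT24]; norm_num)
    refine ⟨(abs_sub_le_of_near (Or.inr rfl) ha.le ha'.le (norm_ideal_strut (starLab_mem m)) hXc hA1).trans
      (by linarith), fun v => ?_⟩
    rw [if_neg hE, ← hF]
    refine adjacent_odd F h9 h1 h9' h1' hB0 (hB _ hm₁) (hB _ hm₂) (hB _ hm₃) (hB _ hm₄) (fun h4 x => ?_) v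
    simp only [hF] at h4 ⊢
    exact two_frames_sq_le_of_orthogonal hn A A' (Or.inr rfl) ha ha' one_pos (by norm_num) (by norm_num) o11 o22
      o33 o12 o13 o23 h4 x

end Summit.AtomisticToContinuum.Crystallization.Theorems.PalmUnimodularRigidity.LayeredLawsSelectHcp

end
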